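import Mathlib.AlgebraicTopology.FundamentalGroupoid.FundamentalGroup
import Literature.Topology.FourManifolds.MappingClassGroup
import Literature.Topology.FourManifolds.OrientedDehnTwist
import Literature.AlgebraicTopology.SingularHomology.PoincareDuality
import HarnessLib

/-!
# Dehn-twist factorisations in `Mod(P, ∂P)`: signed words, Hurwitz moves, completeness

Topic `Literature/Topology/FourManifolds`.  Third file of the definition request
`defn-DehnTwistFactorisation` (crux `ConvexBisection.ContractibleTwistedDoubleStandard`, idea card
`achiral-hurwitz-untwisting`; also wanted for Wendl's normal form and the planar finiteness facts),
after `MappingClassGroup.lean` (`Mod(P, ∂P) = π₀ Diff(P rel ∂P)`, item (a)) and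
`OrientedDehnTwist.lean` (right-handed twists `T_c` along twisting data `c : TwistCurve P o`,
item (b)).  This file: items (c) positive / achiral factorisations, (d) Hurwitz moves and global
conjugation, (e) complete factorisations.  Everything is a definition or is PROVED; no named facts.

Sources.  D. Auroux, *A stable classification of Lefschetz fibrations*, Geom. Topol. 9 (2005),
§2, Def. 5 (p. 5 of arXiv:math/0412120, read): *"A factorization `F = τ₁ · … · τ_r` in `Map_g` is
an ordered tuple of positive Dehn twists. We say that two factorizations are Hurwitz equivalent
if they can be obtained from each other by a sequence of Hurwitz moves"*
`τᵢ · τᵢ₊₁ → (τᵢ₊₁)_{τᵢ⁻¹} · τᵢ` or `τᵢ · τᵢ₊₁ → τᵢ₊₁ · (τᵢ)_{τᵢ₊₁}` (the conjugate `(τ)_φ` being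
"the Dehn twist along the loop `φ(δ)`"), a Lefschetz fibration being *"characterized by a
factorization of the identity element […] uniquely determined up to Hurwitz equivalence and
simultaneous conjugation of all factors by a same element"*; ibid. Lemma 6 (factorisations of a
central element in any group).  R. E. Gompf, A. I. Stipsicz, *4-Manifolds and Kirby Calculus*
(1999), §8.1–8.2 (achiral Lefschetz fibrations: letters of both chiralities).  S. Akbulut,
B. Ozbagci, Geom. Topol. 5 (2001), §2.1, §2.3 (read): `Map(F, ∂F) = Diff⁺(F, ∂F)/Diff₀⁺(F, ∂F)`,
positive = right-handed twists, functional notation, the global monodromy of a PALF is the product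
of the positive twists along its vanishing cycles.  Completeness is the idea card's clause
"`n = rk H₁(P)` and the normal closure of `{cᵢ}` in `π₁(P)` is everything" (the total space of the
Lefschetz fibration over `D²` with these vanishing cycles is contractible).

## Content (all over a surface `P`, model `𝓡∂ 2`, with a smooth orientation `o`)

* `TwistCurve.twistDiffeo c : DiffRelBoundary (𝓡∂ 2) P` and **`TwistCurve.twist c :
  MappingClassGroupRelBoundary (𝓡∂ 2) P`** — the right-handed Dehn twist `t_c ∈ Mod(P, ∂P)`.
* `RelDiffeo.orientedSubgroup o` — `Diff⁺(M rel S)` (orientation-preserving elements; twists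
  belong to it, `twistDiffeo_mem_orientedSubgroup`); `TwistCurve.mapRel c f hf` — the image datum
  `f(c)` for `f ∈ Diff⁺(P rel ∂P)`, with **`t_{f(c)} = [f] t_c [f]⁻¹`** (`twist_mapRel`).
* `Letter P o := TwistCurve P o × Bool` — a SIGNED letter `(c, ε)` (`true` = positive =
  right-handed = Lefschetz critical point; `false` = negative = anti-Lefschetz), with its element
  `Letter.toClass (c, ε) = t_c^{ε}`; `monodromy w` — the product `t_{c₁}^{ε₁} ⋯ t_{cₙ}^{εₙ}` of a
  word, FIRST LETTER LEFTMOST in functional notation (so the last letter acts first).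
* **`DehnTwistFactorisation o φ`** — an ACHIRAL factorisation of `φ ∈ Mod(P, ∂P)`: a signed word
  with monodromy `φ`; `IsPositiveWord` / `DehnTwistFactorisation.IsPositive` — all signs `+`
  (Auroux's factorisations); `PositiveFactorisation o φ` as the subtype.
* MOVES: `Letter.act x d = t_x^{ε}(d)` (image datum), the Hurwitz move
  `(x, y) ↦ (t_x^{ε}(y), x)` with signs carried and its inverse `(x, y) ↦ (y, t_y^{-η}(x))`
  (`HurwitzStep`), global conjugation by `g ∈ Diff⁺(P rel ∂P)` (`conjWord`), the move relation
  `Move` and the equivalence `HurwitzEquivalent` it generates; PROVED: Hurwitz moves preserve the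
  monodromy (`HurwitzStep.monodromy_eq`), conjugation conjugates it (`monodromy_conjWord`).
* COMPLETENESS: `TwistCurve.coreLoop` (the core curve as a loop), `TwistCurve.coreClasses p` (its
  conjugacy class in `π₁(P, p)`), `IsComplete w`: `w.length = b₁(P)` (tree `bettiNumber ℤ P 1`)
  and the core curves of `w` normally generate `π₁(P, p)` for every base point `p`.

## Not here (deliberately)

* HOPF (positive) STABILISATION `P ↝ P ∪ 1-handle`, `w ↝ w · (c, +)` with `c` through the handle
  once: it needs the inclusion homomorphism `Mod(P, ∂P) → Mod(P', ∂P')` (Farb–Margalit Thm. 3.18,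
  extension by the identity after flattening near `∂P`), which the tree does not have; to be filed
  with that homomorphism.  The planar, combinatorial shadow of all three moves exists in
  `PlanarAchiralWords.lean` (`PlanarWords.Move.stabilize`).
* No statement that `t_c` depends only on the isotopy class of the core, that twists generate
  `Mod(P, ∂P)`, or any braid/lantern relation (theorems, not needed to define the calculus).
* Words are plain lists of letters; a `TwistCurve` is a curve WITH a chosen oriented tubular
  neighbourhood, so Hurwitz moves act on honest data and `t_{f(c)} = f t_c f⁻¹` holds on the nose.

## References

* D. Auroux, *A stable classification of Lefschetz fibrations*, Geom. Topol. 9 (2005) 203–217,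
  §2 Def. 5, Lemma 6. [Auroux2005]
* R. E. Gompf, A. I. Stipsicz, *4-Manifolds and Kirby Calculus*, GSM 20 (1999), §8.1–8.2.
  [GompfStipsiczGSM1999]
* S. Akbulut, B. Ozbagci, *Lefschetz fibrations on compact Stein surfaces*, Geom. Topol. 5
  (2001), §2. [AkbulutOzbagci2001]
* J. B. Etnyre, T. Fuller, *Realizing 4-manifolds as achiral Lefschetz fibrations*, IMRN 2006,
  §2 (arXiv:math/0510008 p. 4, read). [EtnyreFuller2006]
* B. Farb, D. Margalit, *A Primer on Mapping Class Groups* (2012), §2.1, Fact 3.7, Thm. 3.18.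
  [FarbMargalit2012]
-/

open scoped Manifold ContDiff Topology
open Set Function

noncomputable section

namespace Literature.Topology.FourManifolds

/-- Local notation: `𝔼 n` is the model Euclidean space `EuclideanSpace ℝ (Fin n)`. -/
local notation "𝔼 " n:arg => EuclideanSpace ℝ (Fin n)

/-- Local notation: `𝕊 n` is the unit sphere in `EuclideanSpace ℝ (Fin (n + 1))`. -/
local notation "𝕊 " n:arg => (Metric.sphere (0 : EuclideanSpace ℝ (Fin (n + 1))) 1)

/-! ### `Diff⁺(M rel S)`: the orientation-preserving subgroup -/

namespace RelDiffeo

variable {E H : Type*} [NormedAddCommGroup E] [NormedSpace ℝ E] [TopologicalSpace H]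
  {I : ModelWithCorners ℝ E H} {M : Type*} [TopologicalSpace M] [ChartedSpace H M]
  [IsManifold I ∞ M] {S : Set M}

variable (S) in
/-- **`Diff⁺(M rel S)`**: the elements of `Diff(M rel S)` preserving the smooth orientation `o`
(a subgroup: `Diffeomorph.IsOrientationPreserving.trans_holds / symm_holds`).  Akbulut–Ozbagci
2001, §2.1: `Diff⁺(F, ∂F)`. [cite: AkbulutOzbagci2001, §2.1] -/
def orientedSubgroup (o : SmoothOrientation I M) : Subgroup (RelDiffeo I M S) where
  carrier := {f | f.toDiffeomorph.IsOrientationPreserving o o}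
  one_mem' := Diffeomorph.isOrientationPreserving_refl o
  mul_mem' hf hg := Diffeomorph.IsOrientationPreserving.trans_holds hg hf (by simp)
  inv_mem' hf := Diffeomorph.IsOrientationPreserving.symm_holds hf (by simp)

/-- Membership in `Diff⁺(M rel S)`. [folklore] -/
@[simp] theorem mem_orientedSubgroup_iff (o : SmoothOrientation I M) (f : RelDiffeo I M S) :
    f ∈ orientedSubgroup S o ↔ f.toDiffeomorph.IsOrientationPreserving o o :=
  Iff.rfl

end RelDiffeo

section Surface

variable {P : Type*} [TopologicalSpace P] [T2Space P] [ChartedSpace (EuclideanHalfSpace 2) P]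
  [IsManifold (𝓡∂ 2) ∞ P] {o : SmoothOrientation (𝓡∂ 2) P}

/-! ### The twist `t_c ∈ Mod(P, ∂P)` and `t_{f(c)} = f t_c f⁻¹` -/

namespace TwistCurve

variable (c : TwistCurve P o)

/-- The right-handed Dehn twist about `c` as an element of `Diff(P rel ∂P)` (it fixes `∂P`
pointwise, `twistDiffeomorph_apply_of_mem_boundary`). [cite: Etnyre2006, §6 (Appendix)] -/
def twistDiffeo : DiffRelBoundary (𝓡∂ 2) P :=
  ⟨c.twistDiffeomorph, fun _ hx => c.twistDiffeomorph_apply_of_mem_boundary hx⟩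

/-- `twistDiffeo` is `twistDiffeomorph` as a function. [folklore] -/
@[simp] theorem coe_twistDiffeo : ⇑c.twistDiffeo = c.twistDiffeomorph := rfl

/-- **The right-handed Dehn twist `t_c ∈ Mod(P, ∂P)`** about the core curve of `c`: the class of
`twistDiffeo c` (Akbulut–Ozbagci 2001, §2.1: `D(α) ∈ Map(F, ∂F)`; Farb–Margalit §3.1.1: `T_a`).
[cite: AkbulutOzbagci2001, §2.1] -/
def twist : MappingClassGroupRelBoundary (𝓡∂ 2) P :=
  MappingClassGroup.mk _ _ _ c.twistDiffeo

/-- `t_c = [twistDiffeo c]`. [folklore] -/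
theorem twist_def : c.twist = MappingClassGroup.mk _ _ _ c.twistDiffeo := rfl

/-- Twists are orientation preserving: `twistDiffeo c ∈ Diff⁺(P rel ∂P)`. [folklore] -/
theorem twistDiffeo_mem_orientedSubgroup :
    c.twistDiffeo ∈ RelDiffeo.orientedSubgroup ((𝓡∂ 2).boundary P) o :=
  c.isOrientationPreserving_twistDiffeomorph

/-- **The image datum `f(c)`** for `f ∈ Diff⁺(P rel ∂P)` (chart `f ∘ e`). [cite: FarbMargalit2012, Fact 3.7] -/
def mapRel (f : DiffRelBoundary (𝓡∂ 2) P)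
    (hf : f ∈ RelDiffeo.orientedSubgroup ((𝓡∂ 2).boundary P) o) : TwistCurve P o :=
  c.map f.toDiffeomorph f.apply_eq_self hf

omit [T2Space P] in
/-- The chart of `f(c)` is `f ∘ e`. [folklore] -/
@[simp] theorem mapRel_apply (f : DiffRelBoundary (𝓡∂ 2) P)
    (hf : f ∈ RelDiffeo.orientedSubgroup ((𝓡∂ 2).boundary P) o) (a : (𝕊 1) × ℝ) :
    (c.mapRel f hf) a = f (c a) := rfl

/-- **`T_{f(c)} = f T_c f⁻¹` in `Diff(P rel ∂P)`**, on the nose. [cite: Etnyre2006, §6 (Appendix)] -/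
theorem twistDiffeo_mapRel (f : DiffRelBoundary (𝓡∂ 2) P)
    (hf : f ∈ RelDiffeo.orientedSubgroup ((𝓡∂ 2).boundary P) o) :
    (c.mapRel f hf).twistDiffeo = f * c.twistDiffeo * f⁻¹ := by
  refine RelDiffeo.ext fun y => ?_
  show (c.map f.toDiffeomorph f.apply_eq_self hf).twistDiffeomorph y =
    f (c.twistDiffeomorph (f⁻¹ y))
  rw [c.twistDiffeomorph_map]
  rfl

/-- **`t_{f(c)} = [f] t_c [f]⁻¹` in `Mod(P, ∂P)`** (Farb–Margalit Fact 3.7; Auroux §2: the conjugate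
of the twist along `δ` is the twist along `φ(δ)`). [cite: FarbMargalit2012, Fact 3.7] -/
theorem twist_mapRel (f : DiffRelBoundary (𝓡∂ 2) P)
    (hf : f ∈ RelDiffeo.orientedSubgroup ((𝓡∂ 2).boundary P) o) :
    (c.mapRel f hf).twist = MappingClassGroup.mk _ _ _ f * c.twist * (MappingClassGroup.mk _ _ _ f)⁻¹ := by
  rw [twist, twistDiffeo_mapRel, map_mul, map_mul, map_inv, twist]

end TwistCurve

/-! ### Signed letters, words and their monodromy -/

variable (P o) in
/-- **A signed letter `(c, ε)`**: a twisting datum and a sign, `true` = positive (the right-handed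
twist `t_c`, a Lefschetz critical point with vanishing cycle the core of `c`), `false` = negative
(`t_c⁻¹`: Etnyre–Fuller 2006, §2, "the contribution to the monodromy [of a negative critical point]
will be a left handed Dehn twist `D_{γ_p}⁻¹` about the vanishing cycle"; Gompf–Stipsicz §8.1–8.2).
[cite: EtnyreFuller2006, §2] -/
abbrev Letter : Type _ := TwistCurve P o × Bool

namespace Letter

/-- The formal inverse letter `(c, ε) ↦ (c, -ε)`. [folklore] -/
def inv (x : Letter P o) : Letter P o := (x.1, !x.2)

omit [T2Space P] in
/-- The formal inverse is an involution. [folklore] -/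
@[simp] theorem inv_inv (x : Letter P o) : x.inv.inv = x := by
  simp [inv]

/-- The representative `t_c^{ε} ∈ Diff(P rel ∂P)` of a letter. [folklore] -/
def toDiffeo (x : Letter P o) : DiffRelBoundary (𝓡∂ 2) P :=
  if x.2 then x.1.twistDiffeo else x.1.twistDiffeo⁻¹

/-- Representative of a positive letter. [folklore] -/
@[simp] theorem toDiffeo_true (c : TwistCurve P o) : toDiffeo (c, true) = c.twistDiffeo := rfl

/-- Representative of a negative letter. [folklore] -/
@[simp] theorem toDiffeo_false (c : TwistCurve P o) : toDiffeo (c, false) = c.twistDiffeo⁻¹ := rfl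

/-- The representative of the inverse letter is the inverse. [folklore] -/
@[simp] theorem toDiffeo_inv (x : Letter P o) : x.inv.toDiffeo = x.toDiffeo⁻¹ := by
  obtain ⟨c, _ | _⟩ := x <;> simp [inv, toDiffeo]

/-- Representatives of letters are orientation preserving. [folklore] -/
theorem toDiffeo_mem_orientedSubgroup (x : Letter P o) :
    x.toDiffeo ∈ RelDiffeo.orientedSubgroup ((𝓡∂ 2).boundary P) o := by
  obtain ⟨c, _ | _⟩ := x
  · exact inv_mem c.twistDiffeo_mem_orientedSubgroup
  · exact c.twistDiffeo_mem_orientedSubgroup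

/-- **The mapping class `t_c^{ε} ∈ Mod(P, ∂P)` of a letter.** [cite: Auroux2005, §2 Def. 5] -/
def toClass (x : Letter P o) : MappingClassGroupRelBoundary (𝓡∂ 2) P :=
  MappingClassGroup.mk _ _ _ x.toDiffeo

/-- Class of a positive letter: `t_c`. [folklore] -/
@[simp] theorem toClass_true (c : TwistCurve P o) : toClass (c, true) = c.twist := rfl

/-- Class of a negative letter: `t_c⁻¹`. [folklore] -/
@[simp] theorem toClass_false (c : TwistCurve P o) : toClass (c, false) = c.twist⁻¹ := by
  simp [toClass, toDiffeo, TwistCurve.twist_def]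

/-- Class of the inverse letter. [folklore] -/
@[simp] theorem toClass_inv (x : Letter P o) : x.inv.toClass = x.toClass⁻¹ := by
  simp [toClass]

/-- **The action of a letter on twisting data**: `x · d = t_c^{ε}(d)`, the image datum of `d` under
the representative of `x = (c, ε)` (chart `t_c^{ε} ∘ e_d`). [cite: Auroux2005, §2] -/
def act (x : Letter P o) (d : TwistCurve P o) : TwistCurve P o :=
  d.mapRel x.toDiffeo x.toDiffeo_mem_orientedSubgroup

/-- **`t_{x·d} = t_x^{ε} t_d t_x^{-ε}`**: twisting along the moved datum is the conjugate.
[cite: FarbMargalit2012, Fact 3.7] -/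
theorem twist_act (x : Letter P o) (d : TwistCurve P o) :
    (x.act d).twist = x.toClass * d.twist * x.toClass⁻¹ :=
  d.twist_mapRel _ _

/-- The class of a moved letter `(x · d, η)` is the conjugate `t_x^{ε} t_d^{η} t_x^{-ε}`. [folklore] -/
theorem toClass_act (x : Letter P o) (y : Letter P o) :
    toClass (x.act y.1, y.2) = x.toClass * y.toClass * x.toClass⁻¹ := by
  obtain ⟨d, _ | _⟩ := y
  · rw [toClass_false, toClass_false, twist_act]
    group
  · rw [toClass_true, toClass_true, twist_act]

end Letter

/-- **The monodromy of a signed word** `w = ((c₁, ε₁), …, (cₙ, εₙ))`: the product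
`t_{c₁}^{ε₁} ⋯ t_{cₙ}^{εₙ} ∈ Mod(P, ∂P)`, first letter leftmost in functional notation (so, read as a
composition of maps, the LAST letter acts first) — Etnyre–Fuller 2006, §2: with the vanishing cycles
ordered counter-clockwise, "`f⁻¹(∂D²)` is a `Σ`-bundle over `S¹` with monodromy `D_{p₁} ∘ ⋯ ∘ D_{p_k}`"
(Akbulut–Ozbagci list the cycles in the opposite order and write `D(γₙ) ⋯ D(γ₁)`).
[cite: EtnyreFuller2006, §2] -/
def monodromy (w : List (Letter P o)) : MappingClassGroupRelBoundary (𝓡∂ 2) P :=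
  (w.map Letter.toClass).prod

/-- The empty word has trivial monodromy. [folklore] -/
@[simp] theorem monodromy_nil : monodromy ([] : List (Letter P o)) = 1 := rfl

/-- `monodromy (x :: w) = t_x^{ε} · monodromy w`. [folklore] -/
@[simp] theorem monodromy_cons (x : Letter P o) (w : List (Letter P o)) :
    monodromy (x :: w) = x.toClass * monodromy w := by
  simp [monodromy]

/-- `monodromy (w ++ w') = monodromy w · monodromy w'`. [folklore] -/
@[simp] theorem monodromy_append (w w' : List (Letter P o)) :
    monodromy (w ++ w') = monodromy w * monodromy w' := by
  simp [monodromy]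

/-- **Positive words**: every letter is positive (a tuple of right-handed twists).
[cite: Auroux2005, §2 Def. 5] -/
def IsPositiveWord (w : List (Letter P o)) : Prop := ∀ x ∈ w, x.2 = true

/-- The positive word on a list of twisting data. [folklore] -/
def positiveWord (l : List (TwistCurve P o)) : List (Letter P o) := l.map fun c => (c, true)

omit [T2Space P] in
/-- `positiveWord l` is positive. [folklore] -/
theorem isPositiveWord_positiveWord (l : List (TwistCurve P o)) : IsPositiveWord (positiveWord l) := by
  intro x hx
  obtain ⟨c, -, rfl⟩ := List.mem_map.1 hx
  rfl

/-- The monodromy of a positive word is the product of the twists `t_{c₁} ⋯ t_{cₙ}`. [folklore] -/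
theorem monodromy_positiveWord (l : List (TwistCurve P o)) :
    monodromy (positiveWord l) = (l.map TwistCurve.twist).prod := by
  simp [monodromy, positiveWord, Function.comp_def]

/-! ### Factorisations -/

variable (o) in
/-- **An (achiral) Dehn-twist factorisation of `φ ∈ Mod(P, ∂P)`**: a signed word
`((c₁, ε₁), …, (cₙ, εₙ))` of twisting data with `t_{c₁}^{ε₁} ⋯ t_{cₙ}^{εₙ} = φ` — the monodromy
word of an achiral Lefschetz fibration over `D²` with regular fibre `P` (Gompf–Stipsicz §8.2); a
POSITIVE factorisation (Auroux 2005, Def. 5: "an ordered tuple of positive Dehn twists" with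
product `φ`) is one all of whose signs are `+` (`IsPositive`).  "It is important not to confuse a
factorization (a tuple of Dehn twists) with the product of its factors" (Auroux): the word is the
datum, `monodromy_eq` the constraint. [cite: Auroux2005, §2 Def. 5] -/
structure DehnTwistFactorisation (φ : MappingClassGroupRelBoundary (𝓡∂ 2) P) where
  /-- the signed word of twisting data -/
  word : List (Letter P o)
  /-- its monodromy is `φ` -/
  monodromy_eq : monodromy word = φ

namespace DehnTwistFactorisation

variable {φ : MappingClassGroupRelBoundary (𝓡∂ 2) P}

/-- A factorisation is **positive** when all its letters are. [cite: Auroux2005, §2 Def. 5] -/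
def IsPositive (F : DehnTwistFactorisation o φ) : Prop := IsPositiveWord F.word

/-- The number of letters (singular fibres). [folklore] -/
def length (F : DehnTwistFactorisation o φ) : ℕ := F.word.length

/-- The empty factorisation of the identity. [folklore] -/
def nil : DehnTwistFactorisation o (1 : MappingClassGroupRelBoundary (𝓡∂ 2) P) := ⟨[], rfl⟩

/-- The tautological positive factorisation `(c)` of a twist `t_c`. [folklore] -/
def single (c : TwistCurve P o) : DehnTwistFactorisation o c.twist := ⟨[(c, true)], by simp⟩

/-- `single c` is positive. [folklore] -/
theorem isPositive_single (c : TwistCurve P o) : (single c).IsPositive := by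
  intro x hx
  rw [single, List.mem_singleton] at hx
  rw [hx]

/-- Concatenation: a factorisation of `φ` followed by one of `ψ` is one of `φ ψ`
(Auroux's `F · F'`). [cite: Auroux2005, §2] -/
def append {ψ : MappingClassGroupRelBoundary (𝓡∂ 2) P} (F : DehnTwistFactorisation o φ)
    (G : DehnTwistFactorisation o ψ) : DehnTwistFactorisation o (φ * ψ) :=
  ⟨F.word ++ G.word, by rw [monodromy_append, F.monodromy_eq, G.monodromy_eq]⟩

/-- A signed word IS a factorisation of its monodromy. [folklore] -/
def ofWord (w : List (Letter P o)) : DehnTwistFactorisation o (monodromy w) := ⟨w, rfl⟩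

end DehnTwistFactorisation

variable (o) in
/-- **Positive factorisations of `φ`** (Auroux's factorisations): the achiral ones with all signs
`+`. [cite: Auroux2005, §2 Def. 5] -/
def PositiveFactorisation (φ : MappingClassGroupRelBoundary (𝓡∂ 2) P) : Type _ :=
  {F : DehnTwistFactorisation o φ // F.IsPositive}

/-! ### Moves: Hurwitz moves and global conjugation -/

/-- **One Hurwitz move** on signed words, at any position, or its inverse (Auroux 2005, §2:
`τᵢ · τᵢ₊₁ → (τᵢ₊₁)_{τᵢ⁻¹} · τᵢ` or `τᵢ · τᵢ₊₁ → τᵢ₊₁ · (τᵢ)_{τᵢ₊₁}`; with signs carried as in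
Gompf–Stipsicz §8.2 for achiral fibrations): `(x, y) ↦ (t_x^{ε}(y), x)` — the new first letter is
the datum of `y` moved by `t_x^{ε}`, keeping the sign of `y` — or `(x, y) ↦ (y, t_y^{-η}(x))`.
On classes: `(a, b) ↦ (a b a⁻¹, a)`, resp. `(a, b) ↦ (b, b⁻¹ a b)`. [cite: Auroux2005, §2 Def. 5] -/
def HurwitzStep (w w' : List (Letter P o)) : Prop :=
  ∃ (pre suf : List (Letter P o)) (x y : Letter P o), w = pre ++ x :: y :: suf ∧
    (w' = pre ++ (x.act y.1, y.2) :: x :: suf ∨ w' = pre ++ y :: (y.inv.act x.1, x.2) :: suf)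

/-- **Hurwitz moves preserve the monodromy** (`(a b a⁻¹) a = a b = b (b⁻¹ a b)`).
[cite: Auroux2005, §2] -/
theorem HurwitzStep.monodromy_eq {w w' : List (Letter P o)} (h : HurwitzStep w w') :
    monodromy w' = monodromy w := by
  obtain ⟨pre, suf, x, y, rfl, rfl | rfl⟩ := h
  · simp only [monodromy_append, monodromy_cons, Letter.toClass_act]
    group
  · simp only [monodromy_append, monodromy_cons, Letter.toClass_act, Letter.toClass_inv]
    group

/-- **Global conjugation** of a word by `g ∈ Diff⁺(P rel ∂P)`: move every datum by `g`, keep the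
signs (Auroux: `(F)_φ`, "conjugating each factor of `F` by the element `φ`"). [cite: Auroux2005, §2] -/
def conjWord (g : DiffRelBoundary (𝓡∂ 2) P)
    (hg : g ∈ RelDiffeo.orientedSubgroup ((𝓡∂ 2).boundary P) o) (w : List (Letter P o)) :
    List (Letter P o) :=
  w.map fun x => (x.1.mapRel g hg, x.2)

/-- **Conjugating the word conjugates the monodromy**: `monodromy ((w)_g) = [g] · monodromy w · [g]⁻¹`.
[cite: Auroux2005, §2] -/
theorem monodromy_conjWord (g : DiffRelBoundary (𝓡∂ 2) P)
    (hg : g ∈ RelDiffeo.orientedSubgroup ((𝓡∂ 2).boundary P) o) (w : List (Letter P o)) :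
    monodromy (conjWord g hg w) =
      MappingClassGroup.mk _ _ _ g * monodromy w * (MappingClassGroup.mk _ _ _ g)⁻¹ := by
  induction w with
  | nil => simp [conjWord]
  | cons x w ih =>
    have hx : Letter.toClass (x.1.mapRel g hg, x.2) =
        MappingClassGroup.mk _ _ _ g * x.toClass * (MappingClassGroup.mk _ _ _ g)⁻¹ := by
      obtain ⟨d, _ | _⟩ := x
      · rw [Letter.toClass_false, Letter.toClass_false, TwistCurve.twist_mapRel]
        group
      · rw [Letter.toClass_true, Letter.toClass_true, TwistCurve.twist_mapRel]
    rw [conjWord, List.map_cons, monodromy_cons, ← conjWord, ih, hx, monodromy_cons]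
    group

/-- **The moves** on signed words over a fixed page `P`: a Hurwitz move (or its inverse) and a
global conjugation by an element of `Diff⁺(P rel ∂P)` (Auroux 2005, §2: the two moves up to which
the monodromy factorisation of a Lefschetz fibration is determined).  Hopf stabilisation, which
changes the page, is not a move of this relation (see the module docstring). [cite: Auroux2005, §2] -/
inductive Move : List (Letter P o) → List (Letter P o) → Prop
  /-- a Hurwitz move or an inverse Hurwitz move -/
  | hurwitz {w w' : List (Letter P o)} (h : HurwitzStep w w') : Move w w'
  /-- global conjugation by `g ∈ Diff⁺(P rel ∂P)` -/
  | conj (g : DiffRelBoundary (𝓡∂ 2) P)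
      (hg : g ∈ RelDiffeo.orientedSubgroup ((𝓡∂ 2).boundary P) o) (w : List (Letter P o)) :
      Move w (conjWord g hg w)

/-- **A move changes the monodromy by a conjugation** (by `1` for a Hurwitz move); in particular
factorisations of the identity go to factorisations of the identity. [cite: Auroux2005, §2] -/
theorem Move.exists_monodromy_eq {w w' : List (Letter P o)} (h : Move w w') :
    ∃ g : MappingClassGroupRelBoundary (𝓡∂ 2) P, monodromy w' = g * monodromy w * g⁻¹ := by
  cases h with
  | hurwitz h => exact ⟨1, by rw [h.monodromy_eq, one_mul, inv_one, mul_one]⟩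
  | conj g hg w => exact ⟨_, monodromy_conjWord g hg w⟩

/-- Moves preserve "monodromy `= 1`". [folklore] -/
theorem Move.monodromy_eq_one {w w' : List (Letter P o)} (h : Move w w') (hw : monodromy w = 1) :
    monodromy w' = 1 := by
  obtain ⟨g, hg⟩ := h.exists_monodromy_eq
  rw [hg, hw, mul_one, mul_inv_cancel]

/-- **Hurwitz equivalence (with global conjugation)**: the equivalence relation on signed words
generated by the moves (Auroux 2005, Def. 5 and the displayed equivalence). [cite: Auroux2005, §2 Def. 5] -/
def HurwitzEquivalent : List (Letter P o) → List (Letter P o) → Prop :=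
  Relation.ReflTransGen fun w w' => Move w w' ∨ Move w' w

/-- Hurwitz equivalence is reflexive. [folklore] -/
theorem HurwitzEquivalent.refl (w : List (Letter P o)) : HurwitzEquivalent w w :=
  Relation.ReflTransGen.refl

/-- A move is a Hurwitz equivalence. [folklore] -/
theorem Move.hurwitzEquivalent {w w' : List (Letter P o)} (h : Move w w') : HurwitzEquivalent w w' :=
  Relation.ReflTransGen.single (Or.inl h)

/-- Hurwitz equivalence is symmetric. [folklore] -/
theorem HurwitzEquivalent.symm {w w' : List (Letter P o)} (h : HurwitzEquivalent w w') :
    HurwitzEquivalent w' w := by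
  unfold HurwitzEquivalent at h ⊢
  induction h with
  | refl => exact Relation.ReflTransGen.refl
  | tail _ hbc ih => exact Relation.ReflTransGen.head hbc.symm ih

/-- Hurwitz equivalence is transitive. [folklore] -/
theorem HurwitzEquivalent.trans {w w' w'' : List (Letter P o)} (h : HurwitzEquivalent w w')
    (h' : HurwitzEquivalent w' w'') : HurwitzEquivalent w w'' :=
  Relation.ReflTransGen.trans h h'

/-- **Hurwitz-equivalent words have conjugate monodromies.** [cite: Auroux2005, §2] -/
theorem HurwitzEquivalent.exists_monodromy_eq {w w' : List (Letter P o)} (h : HurwitzEquivalent w w') :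
    ∃ g : MappingClassGroupRelBoundary (𝓡∂ 2) P, monodromy w' = g * monodromy w * g⁻¹ := by
  unfold HurwitzEquivalent at h
  induction h with
  | refl => exact ⟨1, by group⟩
  | @tail u v _ hbc ih =>
    obtain ⟨g, hg⟩ := ih
    rcases hbc with hbc | hbc
    · obtain ⟨g', hg'⟩ := hbc.exists_monodromy_eq
      exact ⟨g' * g, by rw [hg', hg]; group⟩
    · obtain ⟨g', hg'⟩ := hbc.exists_monodromy_eq
      refine ⟨g'⁻¹ * g, ?_⟩
      rw [hg] at hg'
      calc monodromy v = g'⁻¹ * (g' * monodromy v * g'⁻¹) * g' := by group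
        _ = g'⁻¹ * (g * monodromy w * g⁻¹) * g' := by rw [hg']
        _ = g'⁻¹ * g * monodromy w * (g'⁻¹ * g)⁻¹ := by group

/-- Hurwitz-equivalent words: one is a factorisation of the identity iff the other is. [folklore] -/
theorem HurwitzEquivalent.monodromy_eq_one_iff {w w' : List (Letter P o)} (h : HurwitzEquivalent w w') :
    monodromy w = 1 ↔ monodromy w' = 1 := by
  obtain ⟨g, hg⟩ := h.exists_monodromy_eq
  constructor
  · intro hw; rw [hg, hw, mul_one, mul_inv_cancel]
  · intro hw'
    rw [hw'] at hg
    calc monodromy w = g⁻¹ * (g * monodromy w * g⁻¹) * g := by group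
      _ = 1 := by rw [← hg]; group

/-! ### Complete factorisations -/

namespace TwistCurve

variable (c : TwistCurve P o)

/-- **The core curve of a twisting datum as a loop** `s ↦ e (R_{2πs} p₀, 1/2)` based at
`e (p₀, 1/2)`. [folklore] -/
def coreLoop : Path (c.core (spherePt 1)) (c.core (spherePt 1)) where
  toFun s := c.core (rotateCircle (2 * Real.pi * (s : ℝ)) (spherePt 1))
  continuous_toFun := by
    -- continuity of `s ↦ R_{2πs} p₀` through the coercion `𝕊 1 ↪ ℝ²` (`rotateCircleAux`)
    have h2 : Continuous fun s : unitInterval => rotateCircle (2 * Real.pi * (s : ℝ)) (spherePt 1) := by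
      refine (Topology.IsInducing.subtypeVal.continuous_iff).2 ?_
      simp only [Function.comp_def, coe_rotateCircle]
      exact contDiff_rotateCircleAux.continuous.comp
        ((continuous_const.mul continuous_subtype_val).prodMk continuous_const)
    show Continuous fun s : unitInterval =>
      c.toAnnulusChart (rotateCircle (2 * Real.pi * (s : ℝ)) (spherePt 1), (1 / 2 : ℝ))
    exact c.toAnnulusChart.continuous.comp (h2.prodMk continuous_const)
  source' := by
    show c.toAnnulusChart (rotateCircle (2 * Real.pi * ((0 : unitInterval) : ℝ)) (spherePt 1), (1 / 2 : ℝ)) =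
      c.toAnnulusChart (spherePt 1, (1 / 2 : ℝ))
    rw [Set.Icc.coe_zero, mul_zero, rotateCircle_zero]
  target' := by
    show c.toAnnulusChart (rotateCircle (2 * Real.pi * ((1 : unitInterval) : ℝ)) (spherePt 1), (1 / 2 : ℝ)) =
      c.toAnnulusChart (spherePt 1, (1 / 2 : ℝ))
    rw [Set.Icc.coe_one, mul_one, rotateCircle_two_pi]

/-- **The classes of the core curve in `π₁(P, p)`**: all `[δ · γ_c · δ⁻¹]` for paths `δ` from `p`
to the base point of the core loop `γ_c` — the conjugacy class of the free loop (empty if `p` lies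
in another path component). [folklore] -/
def coreClasses (p : P) : Set (FundamentalGroup P p) :=
  {g | ∃ δ : Path p (c.core (spherePt 1)),
    g = FundamentalGroup.fromPath ⟦δ.trans (c.coreLoop.trans δ.symm)⟧}

end TwistCurve

/-- **Complete signed words.**  A word `w = ((c₁, ε₁), …, (cₙ, εₙ))` over the page `P` is COMPLETE
when `n = b₁(P) = rk H₁(P; ℤ)` (tree `bettiNumber ℤ P 1`) and the core curves `c₁, …, cₙ` normally
generate `π₁(P, p)` at every base point `p` (the normal closure of their conjugacy classes is
everything) — for a connected page with boundary exactly the condition that the Lefschetz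
2-handlebody `P × D² ∪ h(c₁) ∪ ⋯ ∪ h(cₙ)` be contractible (`π₁ = π₁(P)/⟪cᵢ⟫ = 1` and
`χ = χ(P) + n = 1`); idea card `achiral-hurwitz-untwisting`: "complete factorisations (`m`
letters on each side, `m = rk H₁(P)`, each family normally generating `π₁(P)`: contractible total
space)". [folklore] -/
structure IsComplete (w : List (Letter P o)) : Prop where
  /-- as many letters as the first Betti number of the page -/
  length_eq : w.length = Literature.AlgebraicTopology.SingularHomology.bettiNumber ℤ P 1
  /-- the core curves normally generate the fundamental group, at every base point -/
  normalClosure_eq_top : ∀ p : P,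
    Subgroup.normalClosure (⋃ x ∈ w, TwistCurve.coreClasses x.1 p) = ⊤

variable (o) in
/-- **A complete (achiral) factorisation of `φ`.** [folklore] -/
def DehnTwistFactorisation.IsComplete {φ : MappingClassGroupRelBoundary (𝓡∂ 2) P}
    (F : DehnTwistFactorisation o φ) : Prop :=
  Literature.Topology.FourManifolds.IsComplete F.word

omit [T2Space P] in
/-- Completeness only depends on the underlying curves, not on the signs: it is invariant under
flipping any signs. [folklore] -/
theorem IsComplete.of_map_curve_eq {w w' : List (Letter P o)} (h : w.map Prod.fst = w'.map Prod.fst)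
    (hw : IsComplete w) : IsComplete w' := by
  have hlen : w.length = w'.length := by simpa using congrArg List.length h
  refine ⟨hlen ▸ hw.length_eq, fun p => ?_⟩
  have hset : (⋃ x ∈ w', TwistCurve.coreClasses x.1 p) = ⋃ x ∈ w, TwistCurve.coreClasses x.1 p := by
    ext g
    simp only [mem_iUnion, exists_prop]
    constructor
    · rintro ⟨x, hx, hg⟩
      obtain ⟨y, hy, hyx⟩ : ∃ y ∈ w, y.1 = x.1 := by
        have : x.1 ∈ w.map Prod.fst := by rw [h]; exact List.mem_map_of_mem hx
        simpa using this
      exact ⟨y, hy, hyx ▸ hg⟩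
    · rintro ⟨x, hx, hg⟩
      obtain ⟨y, hy, hyx⟩ : ∃ y ∈ w', y.1 = x.1 := by
        have : x.1 ∈ w'.map Prod.fst := by rw [← h]; exact List.mem_map_of_mem hx
        simpa using this
      exact ⟨y, hy, hyx ▸ hg⟩
  rw [hset]
  exact hw.normalClosure_eq_top p

end Surface

end Literature.Topology.FourManifolds

end
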